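import Mathlib
import HarnessLib
import Literature.NumberTheory.Transcendental.KZCalculus
import Literature.NumberTheory.Transcendental.KZProductIdeal
import Literature.NumberTheory.Transcendental.KZUnfoldedStokesProofs
import Summits.KontsevichZagierPeriods.KontsevichZagierPeriods.Theorems.MzvKernelInKZ.Negative.ZetaTwo
import Summits.KontsevichZagierPeriods.KontsevichZagierPeriods.Theorems.LinRedNormalFormDihedralNormalFormStubAtomReductionAux1

/-!
# Stub `stub_exactToFacesTwo` of line `tame-bv-stokes` (crux `DihedralNormalForm`) — tools III

Support file for the stub `stub_exactToFacesTwo`: **absolute convergence of a cubical atom of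
dimension two forces its exponents.** If `q ≠ 0` and
`q · x₀^{a₀} x₁^{a₁} (1-x₀)^{e₀₀} (1-x₁)^{e₁₁} (1-x₀x₁)^{e₀₁}` (integer powers) is the integrand of
an integral representation on the open square, then

  `0 ≤ a₀, 0 ≤ a₁, 0 ≤ e₀₀, 0 ≤ e₁₁` and `-(e₀₀ + e₁₁ + 1) ≤ e₀₁`

(`facesTwo_exponents`, registered sub-goal `stub_exactToFacesTwoAux3`). Proof: on the box
`(0, ½)²` near a vertex the harmless factors are continuous and non-vanishing on the closed box, so
they may be stripped (`IntegrableOn.continuousOn_mul_of_subset`), leaving a Laurent monomial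
`x₀^{γ₀} x₁^{γ₁}` integrable on `(0, ½)²`, whence `γᵢ > -1` (Lemma B of the torus-descent tools,
`AtomReduction.stub_atomReduction_lowestPower`, with the constant polynomial `1`):

* the vertex `(0,0)` gives `a₀, a₁ ≥ 0` (`facesTwo_origin`);
* the corner `(1,1)`: after the flip `x ↦ 1 - x`
  (`AtomReduction.integrableOn_cube_comp_one_sub_iff`) and the blow-up `(x₀, x₁) ↦ (x₀, x₀x₁)`
  of the sector `{x₁ < x₀}` (the cubical chart `cub2` of `Negative/ZetaTwo`, Jacobian `x₀`,
  `MeasureTheory.integrableOn_image_iff_integrableOn_abs_det_fderiv_smul`) the integrand becomes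
  `x₀^{e₀₀+e₁₁+e₀₁+1} x₁^{e₁₁}` times a harmless factor, giving `e₁₁ ≥ 0` and the corner
  inequality (`facesTwo_corner`);
* the symmetry `x₀ ↔ x₁` (the re-indexed representation, `KZ.IntegralRep.reindex`) gives
  `e₀₀ ≥ 0`.

References: M. Kontsevich, D. Zagier, *Periods* (2001), §1.1 (absolute convergence is part of the
definition of a period integral).
-/

noncomputable section

open MeasureTheory Set
open Literature.NumberTheory.Transcendental
open Summit.KontsevichZagierPeriods.MzvKernelInKZ.Negative
open Summit.KontsevichZagierPeriods.DihedralNormalForm.TorusDescent.AtomReduction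
  (integrableOn_cube_comp_one_sub_iff stub_atomReduction_lowestPower)

namespace Summit.KontsevichZagierPeriods.DihedralNormalForm.TameBVStokes

/-! ### Stripping a harmless factor on the box `(0, ½)²` -/

/-- **Stripping lemma.** If `F` is integrable on the open square and `g` is continuous on the
closed box `[0, ½]²` with `g · F = x₀^{γ₀} x₁^{γ₁}` on the open box `(0, ½)²`, then `γ₀, γ₁ > -1`
(Lemma B of the torus-descent tools with the constant polynomial `1`). -/
theorem facesTwo_strip {F g : (Fin 2 → ℝ) → ℝ} (hF : IntegrableOn F (KZ.unitCube 2))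
    (hg : ContinuousOn g (Set.pi Set.univ fun _ : Fin 2 => Set.Icc (0:ℝ) (1 / 2)))
    (γ₀ γ₁ : ℤ) (heq : ∀ y ∈ (Set.pi Set.univ fun _ : Fin 2 => Set.Ioo (0:ℝ) (1 / 2)),
      g y * F y = y 0 ^ γ₀ * y 1 ^ γ₁) : -1 < γ₀ ∧ -1 < γ₁ := by
  have hBQ : (Set.pi Set.univ fun _ : Fin 2 => Set.Ioo (0:ℝ) (1 / 2)) ⊆ KZ.unitCube 2 :=
    fun y hy i => ⟨((mem_univ_pi.1 hy) i).1, ((mem_univ_pi.1 hy) i).2.trans (by norm_num)⟩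
  have hBK : (Set.pi Set.univ fun _ : Fin 2 => Set.Ioo (0:ℝ) (1 / 2)) ⊆
      (Set.pi Set.univ fun _ : Fin 2 => Set.Icc (0:ℝ) (1 / 2)) :=
    fun y hy => mem_univ_pi.2 fun i => Ioo_subset_Icc_self ((mem_univ_pi.1 hy) i)
  have hK : IsCompact (Set.pi Set.univ fun _ : Fin 2 => Set.Icc (0:ℝ) (1 / 2)) :=
    isCompact_univ_pi fun _ => isCompact_Icc
  have hBm : MeasurableSet (Set.pi Set.univ fun _ : Fin 2 => Set.Ioo (0:ℝ) (1 / 2)) :=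
    MeasurableSet.univ_pi fun _ => measurableSet_Ioo
  have h1 : IntegrableOn (fun y => g y * F y) (Set.pi Set.univ fun _ : Fin 2 => Set.Ioo (0:ℝ) (1 / 2)) :=
    IntegrableOn.continuousOn_mul_of_subset hg (hF.mono_set hBQ) hK hBm hBK
  have h2 : IntegrableOn (fun y : Fin 2 → ℝ =>
      |MvPolynomial.eval y (1 : MvPolynomial (Fin 2) ℝ)| * ∏ l, y l ^ (![γ₀, γ₁] : Fin 2 → ℤ) l)
      (Set.pi Set.univ fun _ : Fin 2 => Set.Ioo (0:ℝ) (1 / 2)) := by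
    refine h1.congr_fun (fun y hy => ?_) hBm
    show g y * F y = _
    rw [heq y hy, map_one, abs_one, one_mul, Fin.prod_univ_two]
    simp
  have h3 := stub_atomReduction_lowestPower 1 (1 : MvPolynomial (Fin 2) ℝ) ![γ₀, γ₁] (1 / 2)
    (by norm_num) h2 0 (by simp)
  have h40 := h3 0
  have h41 := h3 1
  simp only [Finsupp.coe_zero, Pi.zero_apply, CharP.cast_eq_zero, zero_add,
    Matrix.cons_val_zero, Matrix.cons_val_one, Matrix.cons_val_fin_one] at h40 h41
  exact ⟨h40, h41⟩

/-- Membership in the closed box `[0, ½]²`, coordinatewise. -/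
theorem facesTwo_mem_cbox {y : Fin 2 → ℝ}
    (hy : y ∈ (Set.pi Set.univ fun _ : Fin 2 => Set.Icc (0:ℝ) (1 / 2))) :
    (0 ≤ y 0 ∧ y 0 ≤ 1 / 2) ∧ (0 ≤ y 1 ∧ y 1 ≤ 1 / 2) :=
  ⟨(mem_univ_pi.1 hy) 0, (mem_univ_pi.1 hy) 1⟩

/-- Membership in the open box `(0, ½)²`, coordinatewise. -/
theorem facesTwo_mem_box {y : Fin 2 → ℝ}
    (hy : y ∈ (Set.pi Set.univ fun _ : Fin 2 => Set.Ioo (0:ℝ) (1 / 2))) :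
    (0 < y 0 ∧ y 0 < 1 / 2) ∧ (0 < y 1 ∧ y 1 < 1 / 2) :=
  ⟨(mem_univ_pi.1 hy) 0, (mem_univ_pi.1 hy) 1⟩

/-! ### The vertex `(0,0)` -/

/-- **The vertex `(0,0)`**: integrability of the kernel on the open square forces `a₀, a₁ ≥ 0`
(strip the factor `(1-x₀)^{e₀₀} (1-x₁)^{e₁₁} (1-x₀x₁)^{e₀₁}`, continuous and non-vanishing on
`[0, ½]²`). -/
theorem facesTwo_origin (a₀ a₁ e₀₀ e₁₁ e₀₁ : ℤ)
    (hF : IntegrableOn (fun x : Fin 2 → ℝ => x 0 ^ a₀ * x 1 ^ a₁ * (1 - x 0) ^ e₀₀ *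
      (1 - x 1) ^ e₁₁ * (1 - x 0 * x 1) ^ e₀₁) (KZ.unitCube 2)) : 0 ≤ a₀ ∧ 0 ≤ a₁ := by
  have hg : ContinuousOn (fun y : Fin 2 → ℝ =>
      ((1 - y 0) ^ e₀₀ * (1 - y 1) ^ e₁₁ * (1 - y 0 * y 1) ^ e₀₁)⁻¹)
      (Set.pi Set.univ fun _ : Fin 2 => Set.Icc (0:ℝ) (1 / 2)) := by
    refine ContinuousOn.inv₀ ?_ fun y hy => ?_
    · refine ((ContinuousOn.zpow₀ (by fun_prop) e₀₀ fun y hy => Or.inl ?_).mul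
        (ContinuousOn.zpow₀ (by fun_prop) e₁₁ fun y hy => Or.inl ?_)).mul
        (ContinuousOn.zpow₀ (by fun_prop) e₀₁ fun y hy => Or.inl ?_)
      · have := facesTwo_mem_cbox hy; linarith [this.1.2]
      · have := facesTwo_mem_cbox hy; linarith [this.2.2]
      · have := facesTwo_mem_cbox hy; nlinarith [this.1.1, this.1.2, this.2.1, this.2.2]
    · obtain ⟨⟨h00, h01⟩, h10, h11⟩ := facesTwo_mem_cbox hy
      have h1 : (1 : ℝ) - y 0 ≠ 0 := by linarith
      have h2 : (1 : ℝ) - y 1 ≠ 0 := by linarith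
      have h3 : (1 : ℝ) - y 0 * y 1 ≠ 0 := by nlinarith
      exact mul_ne_zero (mul_ne_zero (zpow_ne_zero _ h1) (zpow_ne_zero _ h2)) (zpow_ne_zero _ h3)
  have h := facesTwo_strip hF hg a₀ a₁ fun y hy => by
    obtain ⟨⟨h00, h01⟩, h10, h11⟩ := facesTwo_mem_box hy
    have h1 : (1 : ℝ) - y 0 ≠ 0 := by linarith
    have h2 : (1 : ℝ) - y 1 ≠ 0 := by linarith
    have h3 : (1 : ℝ) - y 0 * y 1 ≠ 0 := by nlinarith
    have hD : (1 - y 0) ^ e₀₀ * (1 - y 1) ^ e₁₁ * (1 - y 0 * y 1) ^ e₀₁ ≠ 0 :=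
      mul_ne_zero (mul_ne_zero (zpow_ne_zero _ h1) (zpow_ne_zero _ h2)) (zpow_ne_zero _ h3)
    calc ((1 - y 0) ^ e₀₀ * (1 - y 1) ^ e₁₁ * (1 - y 0 * y 1) ^ e₀₁)⁻¹ *
          (y 0 ^ a₀ * y 1 ^ a₁ * (1 - y 0) ^ e₀₀ * (1 - y 1) ^ e₁₁ * (1 - y 0 * y 1) ^ e₀₁)
        = ((1 - y 0) ^ e₀₀ * (1 - y 1) ^ e₁₁ * (1 - y 0 * y 1) ^ e₀₁)⁻¹ *
            ((1 - y 0) ^ e₀₀ * (1 - y 1) ^ e₁₁ * (1 - y 0 * y 1) ^ e₀₁) * (y 0 ^ a₀ * y 1 ^ a₁) := by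
          ring
      _ = y 0 ^ a₀ * y 1 ^ a₁ := by rw [inv_mul_cancel₀ hD, one_mul]
  omega

/-! ### The corner `(1,1)` -/

/-- The open simplex `{1 > t₀ > t₁ > 0}` lies in the open square. -/
theorem facesTwo_simplex_subset : simplex 2 ⊆ KZ.unitCube 2 := fun _ ht i => ⟨ht.1 i, ht.2.1 i⟩

/-- **The corner `(1,1)`**: integrability of the kernel on the open square forces `e₁₁ ≥ 0` and
`e₀₁ ≥ -(e₀₀ + e₁₁ + 1)`: flip `x ↦ 1 - x`, blow up the sector `{x₁ < x₀}` by the cubical chart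
`(x₀, x₁) ↦ (x₀, x₀x₁)` (Jacobian `x₀`), and strip the factor
`(1-x₀)^{a₀} (1-x₀x₁)^{a₁} (1 + x₁ - x₀x₁)^{e₀₁}`, which leaves `x₀^{e₀₀+e₁₁+e₀₁+1} x₁^{e₁₁}`. -/
theorem facesTwo_corner (a₀ a₁ e₀₀ e₁₁ e₀₁ : ℤ)
    (hF : IntegrableOn (fun x : Fin 2 → ℝ => x 0 ^ a₀ * x 1 ^ a₁ * (1 - x 0) ^ e₀₀ *
      (1 - x 1) ^ e₁₁ * (1 - x 0 * x 1) ^ e₀₁) (KZ.unitCube 2)) :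
    0 ≤ e₁₁ ∧ -(e₀₀ + e₁₁ + 1) ≤ e₀₁ := by
  -- flip both coordinates
  have hF2 := (integrableOn_cube_comp_one_sub_iff (fun x : Fin 2 → ℝ => x 0 ^ a₀ * x 1 ^ a₁ *
    (1 - x 0) ^ e₀₀ * (1 - x 1) ^ e₁₁ * (1 - x 0 * x 1) ^ e₀₁)).2 hF
  -- restrict to the sector `{x₁ < x₀}` and blow it up
  have hF3 : IntegrableOn _ (cub2 '' cube2) :=
    hF2.mono_set (by rw [image_cub2]; exact facesTwo_simplex_subset)
  have hF4 := (integrableOn_image_iff_integrableOn_abs_det_fderiv_smul volume measurableSet_cube2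
    (fun x _ => (hasFDerivAt_cub2 x).hasFDerivWithinAt) injOn_cub2 _).1 hF3
  -- strip the harmless factor
  have hg : ContinuousOn (fun y : Fin 2 → ℝ =>
      ((1 - y 0) ^ a₀ * (1 - y 0 * y 1) ^ a₁ * (1 + y 1 - y 0 * y 1) ^ e₀₁)⁻¹)
      (Set.pi Set.univ fun _ : Fin 2 => Set.Icc (0:ℝ) (1 / 2)) := by
    refine ContinuousOn.inv₀ ?_ fun y hy => ?_
    · refine ((ContinuousOn.zpow₀ (by fun_prop) a₀ fun y hy => Or.inl ?_).mul
        (ContinuousOn.zpow₀ (by fun_prop) a₁ fun y hy => Or.inl ?_)).mul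
        (ContinuousOn.zpow₀ (by fun_prop) e₀₁ fun y hy => Or.inl ?_)
      · have := facesTwo_mem_cbox hy; linarith [this.1.2]
      · have := facesTwo_mem_cbox hy; nlinarith [this.1.1, this.1.2, this.2.1, this.2.2]
      · have := facesTwo_mem_cbox hy; nlinarith [this.1.1, this.1.2, this.2.1, this.2.2]
    · obtain ⟨⟨h00, h01⟩, h10, h11⟩ := facesTwo_mem_cbox hy
      have h1 : (1 : ℝ) - y 0 ≠ 0 := by linarith
      have h2 : (1 : ℝ) - y 0 * y 1 ≠ 0 := by nlinarith
      have h3 : (1 : ℝ) + y 1 - y 0 * y 1 ≠ 0 := by nlinarith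
      exact mul_ne_zero (mul_ne_zero (zpow_ne_zero _ h1) (zpow_ne_zero _ h2)) (zpow_ne_zero _ h3)
  have h := facesTwo_strip hF4 hg (e₀₀ + e₁₁ + e₀₁ + 1) e₁₁ fun y hy => by
    obtain ⟨⟨h00, h01⟩, h10, h11⟩ := facesTwo_mem_box hy
    have hy0 : y 0 ≠ 0 := h00.ne'
    have h1 : (1 : ℝ) - y 0 ≠ 0 := by linarith
    have h2 : (1 : ℝ) - y 0 * y 1 ≠ 0 := by nlinarith
    have h3 : (1 : ℝ) + y 1 - y 0 * y 1 ≠ 0 := by nlinarith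
    have hD : (1 - y 0) ^ a₀ * (1 - y 0 * y 1) ^ a₁ * (1 + y 1 - y 0 * y 1) ^ e₀₁ ≠ 0 :=
      mul_ne_zero (mul_ne_zero (zpow_ne_zero _ h1) (zpow_ne_zero _ h2)) (zpow_ne_zero _ h3)
    have key : y 0 ^ (e₀₀ + e₁₁ + e₀₁ + 1) = y 0 * y 0 ^ e₀₀ * y 0 ^ e₁₁ * y 0 ^ e₀₁ := by
      rw [zpow_add₀ hy0, zpow_add₀ hy0, zpow_add₀ hy0, zpow_one]
      ring
    have hc0 : cub2 y 0 = y 0 := rfl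
    have hc1 : cub2 y 1 = y 0 * y 1 := rfl
    simp only [det_cub2Deriv, smul_eq_mul, hc0, hc1, abs_of_pos h00]
    have e1 : (1 : ℝ) - (1 - y 0) = y 0 := by ring
    have e2 : (1 : ℝ) - (1 - y 0 * y 1) = y 0 * y 1 := by ring
    have e3 : (1 : ℝ) - (1 - y 0) * (1 - y 0 * y 1) = y 0 * (1 + y 1 - y 0 * y 1) := by ring
    rw [e1, e2, e3, mul_zpow, mul_zpow, key]
    calc ((1 - y 0) ^ a₀ * (1 - y 0 * y 1) ^ a₁ * (1 + y 1 - y 0 * y 1) ^ e₀₁)⁻¹ *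
          (y 0 * ((1 - y 0) ^ a₀ * (1 - y 0 * y 1) ^ a₁ * y 0 ^ e₀₀ * (y 0 ^ e₁₁ * y 1 ^ e₁₁) *
            (y 0 ^ e₀₁ * (1 + y 1 - y 0 * y 1) ^ e₀₁)))
        = ((1 - y 0) ^ a₀ * (1 - y 0 * y 1) ^ a₁ * (1 + y 1 - y 0 * y 1) ^ e₀₁)⁻¹ *
            ((1 - y 0) ^ a₀ * (1 - y 0 * y 1) ^ a₁ * (1 + y 1 - y 0 * y 1) ^ e₀₁) *
            (y 0 * y 0 ^ e₀₀ * y 0 ^ e₁₁ * y 0 ^ e₀₁ * y 1 ^ e₁₁) := by ring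
      _ = y 0 * y 0 ^ e₀₀ * y 0 ^ e₁₁ * y 0 ^ e₀₁ * y 1 ^ e₁₁ := by rw [inv_mul_cancel₀ hD, one_mul]
  omega

/-! ### Assembly -/

/-- The kernel of a representation, and its transpose `x₀ ↔ x₁` (the re-indexed representation),
are integrable on the open square. -/
theorem facesTwo_kernel_integrable (q : ℚ) (hq : q ≠ 0) (a₀ a₁ e₀₀ e₁₁ e₀₁ : ℤ)
    (s : KZ.IntegralRep 2) (hd : s.domain = KZ.unitCube 2)
    (hi : EqOn s.integrand (fun x => (q : ℝ) * (x 0 ^ a₀ * x 1 ^ a₁ * (1 - x 0) ^ e₀₀ *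
      (1 - x 1) ^ e₁₁ * (1 - x 0 * x 1) ^ e₀₁)) (KZ.unitCube 2)) :
    IntegrableOn (fun x : Fin 2 → ℝ => x 0 ^ a₀ * x 1 ^ a₁ * (1 - x 0) ^ e₀₀ * (1 - x 1) ^ e₁₁ *
        (1 - x 0 * x 1) ^ e₀₁) (KZ.unitCube 2) ∧
      IntegrableOn (fun x : Fin 2 → ℝ => x 0 ^ a₁ * x 1 ^ a₀ * (1 - x 0) ^ e₁₁ * (1 - x 1) ^ e₀₀ *
        (1 - x 0 * x 1) ^ e₀₁) (KZ.unitCube 2) := by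
  have hq' : (q : ℝ) ≠ 0 := by exact_mod_cast hq
  have hmeas : MeasurableSet (KZ.unitCube 2) := (KZ.isOpen_unitCube 2).measurableSet
  constructor
  · have h := s.integrableOn
    rw [hd] at h
    refine IntegrableOn.congr_fun ((h.congr_fun hi hmeas).const_mul ((q : ℝ)⁻¹))
      (fun x _ => ?_) hmeas
    show (q : ℝ)⁻¹ * ((q : ℝ) * _) = _
    rw [← mul_assoc, inv_mul_cancel₀ hq', one_mul]
  · have hsw : ∀ w : Fin 2 → ℝ, w ∈ KZ.unitCube 2 ↔
        (fun i => w (Equiv.swap (0 : Fin 2) 1 i)) ∈ KZ.unitCube 2 := by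
      intro w
      simp only [KZ.unitCube, mem_setOf_eq, Fin.forall_fin_two, Equiv.swap_apply_left,
        Equiv.swap_apply_right]
      exact and_comm
    have h := (s.reindex (Equiv.swap (0 : Fin 2) 1)).integrableOn
    have hd' : (s.reindex (Equiv.swap (0 : Fin 2) 1)).domain = KZ.unitCube 2 := by
      show {w : Fin 2 → ℝ | (fun i => w (Equiv.swap (0 : Fin 2) 1 i)) ∈ s.domain} = KZ.unitCube 2
      ext w
      rw [hd, mem_setOf_eq, ← hsw w]
    rw [hd'] at h
    have h' : IntegrableOn (fun x => (q : ℝ) * (x 0 ^ a₁ * x 1 ^ a₀ * (1 - x 0) ^ e₁₁ *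
        (1 - x 1) ^ e₀₀ * (1 - x 0 * x 1) ^ e₀₁)) (KZ.unitCube 2) := by
      refine h.congr_fun (fun w hw => ?_) hmeas
      show s.integrand (fun i => w (Equiv.swap (0 : Fin 2) 1 i)) = _
      rw [hi ((hsw w).1 hw)]
      simp only [Equiv.swap_apply_left, Equiv.swap_apply_right]
      rw [mul_comm (w 1) (w 0)]
      ring
    refine IntegrableOn.congr_fun (h'.const_mul ((q : ℝ)⁻¹)) (fun x _ => ?_) hmeas
    show (q : ℝ)⁻¹ * ((q : ℝ) * _) = _
    rw [← mul_assoc, inv_mul_cancel₀ hq', one_mul]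

/-- **Absolute convergence forces the exponents of a cubical atom of dimension two**: if `q ≠ 0`
and `q · x₀^{a₀} x₁^{a₁} (1-x₀)^{e₀₀} (1-x₁)^{e₁₁} (1-x₀x₁)^{e₀₁}` is the integrand of an integral
representation on the open square, then `a₀, a₁, e₀₀, e₁₁ ≥ 0` and `e₀₁ ≥ -(e₀₀ + e₁₁ + 1)`.
[cite: KontsevichZagier2001, §1.1] -/
theorem facesTwo_exponents (q : ℚ) (hq : q ≠ 0) (a₀ a₁ e₀₀ e₁₁ e₀₁ : ℤ) (s : KZ.IntegralRep 2)
    (hd : s.domain = KZ.unitCube 2)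
    (hi : EqOn s.integrand (fun x => (q : ℝ) * (x 0 ^ a₀ * x 1 ^ a₁ * (1 - x 0) ^ e₀₀ *
      (1 - x 1) ^ e₁₁ * (1 - x 0 * x 1) ^ e₀₁)) (KZ.unitCube 2)) :
    0 ≤ a₀ ∧ 0 ≤ a₁ ∧ 0 ≤ e₀₀ ∧ 0 ≤ e₁₁ ∧ -(e₀₀ + e₁₁ + 1) ≤ e₀₁ := by
  obtain ⟨hK, hKs⟩ := facesTwo_kernel_integrable q hq a₀ a₁ e₀₀ e₁₁ e₀₁ s hd hi
  obtain ⟨ha₀, ha₁⟩ := facesTwo_origin a₀ a₁ e₀₀ e₁₁ e₀₁ hK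
  obtain ⟨he₁₁, hc⟩ := facesTwo_corner a₀ a₁ e₀₀ e₁₁ e₀₁ hK
  obtain ⟨he₀₀, -⟩ := facesTwo_corner a₁ a₀ e₁₁ e₀₀ e₀₁ hKs
  exact ⟨ha₀, ha₁, he₀₀, he₁₁, hc⟩

/-! ### Registered sub-goal -/

/-- Registered sub-goal `stub_exactToFacesTwoAux3` of this file: absolute convergence of a
cubical atom of dimension two forces its exponents (`facesTwo_exponents`). -/
theorem stub_exactToFacesTwoAux3 : ∀ (q : ℚ), q ≠ 0 → ∀ (a₀ a₁ e₀₀ e₁₁ e₀₁ : ℤ) (s : Literature.NumberTheory.Transcendental.KZ.IntegralRep 2), s.domain = {x : Fin 2 → ℝ | ∀ i, x i ∈ Set.Ioo (0:ℝ) 1} → Set.EqOn s.integrand (fun x => (q : ℝ) * (x 0 ^ a₀ * x 1 ^ a₁ * (1 - x 0) ^ e₀₀ * (1 - x 1) ^ e₁₁ * (1 - x 0 * x 1) ^ e₀₁)) {x : Fin 2 → ℝ | ∀ i, x i ∈ Set.Ioo (0:ℝ) 1} → 0 ≤ a₀ ∧ 0 ≤ a₁ ∧ 0 ≤ e₀₀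 ∧ 0 ≤ e₁₁ ∧ -(e₀₀ + e₁₁ + 1) ≤ e₀₁ :=
  fun q hq a₀ a₁ e₀₀ e₁₁ e₀₁ s hd hi => facesTwo_exponents q hq a₀ a₁ e₀₀ e₁₁ e₀₁ s hd hi

end Summit.KontsevichZagierPeriods.DihedralNormalForm.TameBVStokes
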